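import Summits.QuantumFields.YangMills.Theorems.UnitScaleTiltProp7DivRecoveryCutoffReadings
import Summits.QuantumFields.YangMills.Theorems.UnitScaleTiltProp7DivRecoveryAssemblyBudgetW4
import Literature.MathematicalPhysics.QuantumFieldTheory.Balaban1983to89.B7Prop1Explicit
import Literature.MathematicalPhysics.QuantumFieldTheory.Balaban1983to89.B7Eq78Linearization
import HarnessLib

/-!
# Prop. 7 on T³ — lane II [I-9]: THE PER-PATCH α-GROUP COMPOSED AT THE MEMBER

Route `UnitScaleTilt`, crux `MinimiserStabilityRegPr` (stmt-QuantumFields-19200), E′ growth side, lane II «divergence recovery at the curved regular member».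
One patch of the member geometry file (`hPatch` of ✓`Prop7DivRecoveryPatchesToRows.hRows_of_core_and_patches`): given the chart-local potential data of
(B8-member) ∕ w4-19200 g11's `Prop7BoxLocalResidualMember.boxLocalResidual_member` — conjuncts (S2b) (D) (hloc) (L1) (h1) (h2) (h3) (h4) taken AS HYPOTHESES,
token for token — the patch's cutoffs `Z`, `ZE` reading as `ζ`-multiplication (px11 g6 (Z1)(Z2)) with supports inside the chart box (px9 g7 (Z-box)), the chart
injective on the box, the bond set `T` carrying the local energy letter `N_T := c₀Σ_{b∈T}‖y b‖_F²`, and w4 part 3's reading of (h4)'s curl functional in the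
budget's curl letter `Cu`, this file delivers the α-group of `hPatch`'s per-patch rows in the BUDGET CURRENCY `(R₀ = L^s, e)`: `hloc_c`, `hDφ_c`, `Gφ_c ≤ N_T`,
`ρ_c ≤ N_T`, `Φ_c ≤ 576·L^{2s}·N_T`, `ρ_c ≤ 1944Cc·L^{2s}·Cu + 20155392A²·L^{4s}e²·N_T`, `‖Z κs_c‖² ≤ 13824A²·L^{2s}e²·ρ_c` (and the same bound for (h3)'s
left side, the `K_l ≤ K` of the interior `H¹` row).  Tools: ✓`Prop7DivRecoveryCutoffReadings` §4–§5 and ✓`Prop7DivRecoveryAssemblyBudgetW4` §2.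
The chart radius `R` is generic (`1 ≤ R ≤ 4·L^s·ℓ` as a real; px9's record radius satisfies this by ✓`recordRadius_le`), `α ≤ A·e·η²` is the plaquette
currency (px12 g8 (P-box): `α = regThreshold = e·η²`, `A = 1`).

HONEST SCOPE.  Bookkeeping; nothing of (REC)∕hN06∕the crux is proved here; YM₃ on T³ is rung R3 — NOT d = 4, NOT infinite volume, NOT a mass gap, NOT Clay.
[cite: Balaban1985BackgroundPropagators, (3.19)-(3.26) pp.393-395, (3.100) p.413]
-/

noncomputable section

open scoped InnerProductSpace Matrix.Norms.L2Operator BigOperators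

namespace Summit.QuantumFields.YangMills.Theorems.Prop7DivRecoveryPatchAlphaRows

open Literature.MathematicalPhysics.QuantumFieldTheory.Balaban1983to89
open Literature.MathematicalPhysics.QuantumFieldTheory.Balaban1983to89.T3ContinuumYM3Torus
open B11Eq103H1Complex (SiteL2K BondL2K)
open B10Eq27TorusAxialLog (transl)
open B4Eq19LatticeOperators (Zd box unitVec box_mono)
open B7Eq78Linearization (conjR)
open B7Prop1Explicit (axialFn)
open T3SectALandauChart (eta eta_pos)
open Summit.QuantumFields.YangMills.Theorems.Prop7SectET3Transport (periodsT3)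
open Summit.QuantumFields.YangMills.Theorems.Prop7SectET3HilbertLetters (W₂ frobEquiv toL2 toL2S DL2 DstarL2 covLapSite)
open Summit.QuantumFields.YangMills.Theorems.Prop7DivRecoveryCutoffReadings
open Summit.QuantumFields.YangMills.Theorems.Prop7DivRecoveryAssemblyBudgetW4

variable (F : T3Family) (K : ℕ) (c₀ : ℝ) [hc : Fact (0 < c₀)]

/-- ★★★ **[I-9] THE PER-PATCH α-GROUP AT THE MEMBER, IN BUDGET CURRENCY.**  See the module docstring: (B8-member)'s conjuncts in, `hPatch`'s α-rows out
(`R₀ = L^s`; the constants `576`, `1944·Cc`, `20155392·A²`, `13824·A²` are those of ✓`currency_h2`∕`_h4`∕`_h3`).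
[cite: Balaban1985BackgroundPropagators, (3.19)-(3.26) pp.393-395, (3.100) p.413] -/
theorem patch_alpha_rows (n s : ℕ) (W : GaugeField (F.P K) 0 (Matrix.specialUnitaryGroup (Fin 2) ℂ))
    (c : Site (F.P K) 0) (z : Zd (F.P K).d) (R : ℤ) (hR1 : 1 ≤ R)
    (hRf : (R : ℝ) ≤ 4 * (F.L : ℝ) ^ s * (F.L : ℝ) ^ (K - n))
    (hinj : Set.InjOn (transl c) ↑(box z R))
    (V : Zd (F.P K).d → Fin (F.P K).d → (Matrix (Fin 2) (Fin 2) ℂ)ˣ)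
    {α A e : ℝ} (hα : 0 ≤ α) (hαe : α ≤ A * e * eta F n K ^ 2)
    (y r : BondL2K ℂ 3 (periodsT3 F K) c₀ W₂) (φ κs : SiteL2K ℂ 3 (periodsT3 F K) c₀ W₂)
    (φZ : Zd (F.P K).d → Matrix (Fin 2) (Fin 2) ℂ) (m : Matrix (Fin 2) (Fin 2) ℂ)
    (hS2b : ∀ w ∈ box z R, ∀ μ, (toL2 F K c₀).symm r ⟨transl c w, μ⟩
        = if w + unitVec μ ∈ box z R then (toL2 F K c₀).symm y ⟨transl c w, μ⟩ - (conjR (V w μ) (φZ (w + unitVec μ)) - φZ w) else 0)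
    (hD : ∀ w ∈ box z R, ∀ μ, w + unitVec μ ∈ box z R →
        (toL2 F K c₀).symm (DL2 F n K c₀ W φ) ⟨transl c w, μ⟩ = conjR (V w μ) (φZ (w + unitVec μ)) - φZ w)
    (hloc : DstarL2 F n K c₀ W y = covLapSite F n K c₀ W φ + κs)
    (hL1 : ∀ w ∈ box z (R - 1), (toL2S F K c₀).symm κs (transl c w) = (eta F n K)⁻¹ • conjR (axialFn V (fun i => z i - R) w)⁻¹ m)
    (h1 : c₀ * ∑ w ∈ box z R, ∑ μ, (if w + unitVec μ ∈ box z R then ∑ j : Fin 2, ∑ k : Fin 2, ‖((toL2 F K c₀).symm y ⟨transl c w, μ⟩) j k‖ ^ 2 else 0)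
        = c₀ * ∑ w ∈ box z R, ∑ μ, (if w + unitVec μ ∈ box z R then
              ∑ j : Fin 2, ∑ k : Fin 2, ‖(conjR (V w μ) (φZ (w + unitVec μ)) - φZ w) j k‖ ^ 2 else 0)
          + ‖r‖ ^ 2)
    (h2 : ‖φ‖ ^ 2 ≤ 16 * R * (2 * R + 1) * (eta F n K) ^ 2 *
          (c₀ * ∑ w ∈ box z R, ∑ μ, (if w + unitVec μ ∈ box z R then
              ∑ j : Fin 2, ∑ k : Fin 2, ‖(conjR (V w μ) (φZ (w + unitVec μ)) - φZ w) j k‖ ^ 2 else 0)))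
    (h3 : c₀ * ∑ w ∈ box z (R - 1), ∑ j : Fin 2, ∑ k : Fin 2, ‖((eta F n K)⁻¹ • conjR (axialFn V (fun i => z i - R) w)⁻¹ m) j k‖ ^ 2
        ≤ 16 * ((F.P K).d : ℝ) ^ 3 * 2 * R ^ 2 * α ^ 2 * ((eta F n K)⁻¹) ^ 2 * ‖r‖ ^ 2)
    (h4 : ‖r‖ ^ 2 ≤ 24 * (2 * (R : ℝ) + 1) ^ 2 *
            (c₀ * ∑ w ∈ box z R, ∑ μ, ∑ ν, (if w + unitVec μ + unitVec ν ∈ box z R then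
              ∑ j : Fin 2, ∑ k : Fin 2, ‖((toL2 F K c₀).symm y ⟨transl c w, μ⟩
                + conjR (V w μ) ((toL2 F K c₀).symm y ⟨transl c (w + unitVec μ), ν⟩)
                - conjR (V w ν) ((toL2 F K c₀).symm y ⟨transl c (w + unitVec ν), μ⟩)
                - (toL2 F K c₀).symm y ⟨transl c w, ν⟩) j k‖ ^ 2 else 0))
          + 768 * ((F.P K).d : ℝ) ^ 2 * R * (2 * R + 1) ^ 3 * α ^ 2 *
            (c₀ * ∑ w ∈ box z R, ∑ μ, (if w + unitVec μ ∈ box z R then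
              ∑ j : Fin 2, ∑ k : Fin 2, ‖((toL2 F K c₀).symm y ⟨transl c w, μ⟩) j k‖ ^ 2 else 0)))
    {Cc Cu : ℝ} (hCc : 0 ≤ Cc) (hCu : 0 ≤ Cu)
    (hC : c₀ * ∑ w ∈ box z R, ∑ μ, ∑ ν, (if w + unitVec μ + unitVec ν ∈ box z R then
              ∑ j : Fin 2, ∑ k : Fin 2, ‖((toL2 F K c₀).symm y ⟨transl c w, μ⟩
                + conjR (V w μ) ((toL2 F K c₀).symm y ⟨transl c (w + unitVec μ), ν⟩)
                - conjR (V w ν) ((toL2 F K c₀).symm y ⟨transl c (w + unitVec ν), μ⟩)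
                - (toL2 F K c₀).symm y ⟨transl c w, ν⟩) j k‖ ^ 2 else 0)
          ≤ Cc * ((F.L : ℝ) ^ (K - n))⁻¹ ^ 2 * Cu)
    (Z : SiteL2K ℂ 3 (periodsT3 F K) c₀ W₂ →ₗ[ℂ] SiteL2K ℂ 3 (periodsT3 F K) c₀ W₂) (ζ : Site (F.P K) 0 → ℝ)
    (hZ : ∀ φ x, (toL2S F K c₀).symm (Z φ) x = ζ x • (toL2S F K c₀).symm φ x) (h01 : ∀ x, 0 ≤ ζ x ∧ ζ x ≤ 1)
    (hζ : ∀ x, ζ x ≠ 0 → ∃ w ∈ box z (R - 1), transl c w = x)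
    (ZE : BondL2K ℂ 3 (periodsT3 F K) c₀ W₂ →ₗ[ℂ] BondL2K ℂ 3 (periodsT3 F K) c₀ W₂)
    (hZE : ∀ f b, (toL2 F K c₀).symm (ZE f) b = ζ b.src • (toL2 F K c₀).symm f b)
    (hξ : ∀ b : PBond (F.P K) 0, ζ b.src ≠ 0 → ∃ w ∈ box z R, transl c w = b.src ∧ w + unitVec b.dir ∈ box z R)
    (T : Finset (PBond (F.P K) 0))
    (hT : ∀ w ∈ box z R, ∀ μ, w + unitVec μ ∈ box z R → (⟨transl c w, μ⟩ : PBond (F.P K) 0) ∈ T) :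
    Z (DstarL2 F n K c₀ W y) = Z (covLapSite F n K c₀ W φ) + Z κs ∧
    ZE (DL2 F n K c₀ W φ) = ZE y - ZE r ∧
    c₀ * ∑ w ∈ box z R, ∑ μ, (if w + unitVec μ ∈ box z R then
        ∑ j : Fin 2, ∑ k : Fin 2, ‖(conjR (V w μ) (φZ (w + unitVec μ)) - φZ w) j k‖ ^ 2 else 0)
      ≤ c₀ * ∑ b ∈ T, ‖(frobEquiv.symm ((toL2 F K c₀).symm y b) : W₂)‖ ^ 2 ∧
    ‖r‖ ^ 2 ≤ c₀ * ∑ b ∈ T, ‖(frobEquiv.symm ((toL2 F K c₀).symm y b) : W₂)‖ ^ 2 ∧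
    ‖φ‖ ^ 2 ≤ 576 * ((F.L : ℝ) ^ s) ^ 2 * (c₀ * ∑ b ∈ T, ‖(frobEquiv.symm ((toL2 F K c₀).symm y b) : W₂)‖ ^ 2) ∧
    ‖r‖ ^ 2 ≤ 1944 * Cc * ((F.L : ℝ) ^ s) ^ 2 * Cu
      + 20155392 * A ^ 2 * ((F.L : ℝ) ^ s) ^ 4 * e ^ 2 * (c₀ * ∑ b ∈ T, ‖(frobEquiv.symm ((toL2 F K c₀).symm y b) : W₂)‖ ^ 2) ∧
    ‖Z κs‖ ^ 2 ≤ 13824 * A ^ 2 * ((F.L : ℝ) ^ s) ^ 2 * e ^ 2 * ‖r‖ ^ 2 ∧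
    c₀ * ∑ w ∈ box z (R - 1), ∑ j : Fin 2, ∑ k : Fin 2, ‖((eta F n K)⁻¹ • conjR (axialFn V (fun i => z i - R) w)⁻¹ m) j k‖ ^ 2
      ≤ 13824 * A ^ 2 * ((F.L : ℝ) ^ s) ^ 2 * e ^ 2 * ‖r‖ ^ 2 := by
  have hη : 0 < eta F n K := eta_pos F n K
  have hℓη : eta F n K * (F.L : ℝ) ^ (K - n) = 1 := eta_mul_level F K n
  have hone : 1 ≤ (F.L : ℝ) ^ s * (F.L : ℝ) ^ (K - n) := one_le_radius_mul_level F K n s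
  have hL0 : 0 < F.L := by have := F.hL.2; omega
  have hℓ : 0 < (F.L : ℝ) ^ (K - n) := pow_pos (by exact_mod_cast hL0) _
  have hR0 : (0 : ℝ) ≤ (R : ℝ) := by exact_mod_cast (show (0 : ℤ) ≤ R by omega)
  have hd : (F.P K).d = 3 := T3Family.P_d F K
  have hc0 : 0 < c₀ := hc.out
  -- (hloc_c), (hDφ_c)
  have hlocZ : Z (DstarL2 F n K c₀ W y) = Z (covLapSite F n K c₀ W φ) + Z κs := patch_hloc F K c₀ n W Z hloc
  have hDφ : ZE (DL2 F n K c₀ W φ) = ZE y - ZE r :=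
    patch_hDφ F K c₀ n W ZE (fun b => ζ b.src) hZE c z R hξ (fun w μ => conjR (V w μ) (φZ (w + unitVec μ)) - φZ w) hS2b hD
  -- (h1) split, the `N_T` reading
  obtain ⟨hGN, hρN⟩ := patch_h1 F K c₀ z R (fun w μ => (toL2 F K c₀).symm y ⟨transl c w, μ⟩)
    (fun w μ => conjR (V w μ) (φZ (w + unitVec μ)) - φZ w) (sq_nonneg ‖r‖) h1
  have hNT := patch_hN F K c₀ c z R hinj ((toL2 F K c₀).symm y) T hT
  have hG0 := boxBondSum_nonneg F K c₀ z R (fun w μ => conjR (V w μ) (φZ (w + unitVec μ)) - φZ w)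
  have hN0 := boxBondSum_nonneg F K c₀ z R (fun w μ => (toL2 F K c₀).symm y ⟨transl c w, μ⟩)
  have hNT0 : 0 ≤ c₀ * ∑ b ∈ T, ‖(frobEquiv.symm ((toL2 F K c₀).symm y b) : W₂)‖ ^ 2 :=
    mul_nonneg hc0.le (Finset.sum_nonneg fun _ _ => sq_nonneg _)
  -- Φ row
  have hΦG : ‖φ‖ ^ 2 ≤ 576 * ((F.L : ℝ) ^ s) ^ 2 *
      (c₀ * ∑ w ∈ box z R, ∑ μ, (if w + unitVec μ ∈ box z R then
        ∑ j : Fin 2, ∑ k : Fin 2, ‖(conjR (V w μ) (φZ (w + unitVec μ)) - φZ w) j k‖ ^ 2 else 0)) :=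
    currency_h2 hℓη hR0 hRf hone hG0 h2
  have hΦ : ‖φ‖ ^ 2 ≤ 576 * ((F.L : ℝ) ^ s) ^ 2 * (c₀ * ∑ b ∈ T, ‖(frobEquiv.symm ((toL2 F K c₀).symm y b) : W₂)‖ ^ 2) :=
    hΦG.trans (mul_le_mul_of_nonneg_left (hGN.trans hNT) (by positivity))
  -- ρ row (w4's shape)
  have hρc := currency_h4 (d := (F.P K).d) hd hℓη hℓ hR0 hRf hone hα hαe hN0 hCc hCu hC h4
  have hρ : ‖r‖ ^ 2 ≤ 1944 * Cc * ((F.L : ℝ) ^ s) ^ 2 * Cu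
      + 20155392 * A ^ 2 * ((F.L : ℝ) ^ s) ^ 4 * e ^ 2 * (c₀ * ∑ b ∈ T, ‖(frobEquiv.symm ((toL2 F K c₀).symm y b) : W₂)‖ ^ 2) := by
    have hmono : 20155392 * A ^ 2 * ((F.L : ℝ) ^ s) ^ 4 * e ^ 2 *
        (c₀ * ∑ w ∈ box z R, ∑ μ, (if w + unitVec μ ∈ box z R then
          ∑ j : Fin 2, ∑ k : Fin 2, ‖((toL2 F K c₀).symm y ⟨transl c w, μ⟩) j k‖ ^ 2 else 0))
        ≤ 20155392 * A ^ 2 * ((F.L : ℝ) ^ s) ^ 4 * e ^ 2 * (c₀ * ∑ b ∈ T, ‖(frobEquiv.symm ((toL2 F K c₀).symm y b) : W₂)‖ ^ 2) :=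
      mul_le_mul_of_nonneg_left hNT (by positivity)
    linarith
  -- K rows
  have hsub : (↑(box z (R - 1)) : Set (Zd (F.P K).d)) ⊆ ↑(box z R) := Finset.coe_subset.mpr (box_mono z (by omega))
  have hKraw : ‖Z κs‖ ^ 2 ≤ 16 * ((F.P K).d : ℝ) ^ 3 * 2 * R ^ 2 * α ^ 2 * ((eta F n K)⁻¹) ^ 2 * ‖r‖ ^ 2 :=
    patch_hK F K c₀ Z ζ hZ h01 c (box z (R - 1)) (hinj.mono hsub) hζ κs
      (fun w => (eta F n K)⁻¹ • conjR (axialFn V (fun i => z i - R) w)⁻¹ m) hL1 h3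
  have hKcur : 16 * ((F.P K).d : ℝ) ^ 3 * 2 * R ^ 2 * α ^ 2 * ((eta F n K)⁻¹) ^ 2 * ‖r‖ ^ 2
      ≤ 13824 * A ^ 2 * ((F.L : ℝ) ^ s) ^ 2 * e ^ 2 * ‖r‖ ^ 2 :=
    currency_h3 (d := (F.P K).d) hd hℓη hη hR0 hRf hα hαe (sq_nonneg ‖r‖)
  exact ⟨hlocZ, hDφ, hGN.trans hNT, hρN.trans hNT, hΦ, hρ, hKraw.trans hKcur, h3.trans hKcur⟩

end Summit.QuantumFields.YangMills.Theorems.Prop7DivRecoveryPatchAlphaRows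

end
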